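import Summits.Ventures.PercRepro.C041BlockMapClosure

/-!
# ROW C-041 — THEOREM (EAR): the block map of a host with an ear of length `ℓ` added between two vertices is the
block map of the host with the chord added plus `2^ℓ − 2` times the block map of the host (p6, gen 35; the
ear-decomposition step, from THEOREM (PATH) and the loop doubling)

Setting of `C041BlockMapPath` and `C041BlockMapReductions`.  For a host `Z₁` and two vertices `x`, `y`, the host
with the CHORD `addEdge Z₁ x y` has the new edge `none` from `x` to `y`; the EAR of length `n + 1` is the chord
replaced by a path with `n` internal vertices, `ear Z₁ x y n = pathHost (addEdge Z₁ x y) none n`.  The chord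
turned into a loop is a loop at `x` (`loopify_addEdge`), which doubles the block map of `Z₁`
(`blockMap_addLoop`), so THEOREM (PATH) reads **`blockMap_ear`: `Θ_{Z₁ + ear of length n + 1} = Θ_{Z₁ + xy} +
(2^{n+1} − 2) • Θ_{Z₁}`**.  COROLLARY (`inCone_blockMap_ear`, `coneHost_ear`): the cone conjecture for block
maps is closed under adding an ear of any length — if the host with the chord and the host are cone hosts, so is
the host with the ear (the ear decomposition of a 2-connected host from a cycle, one ear at a time).
-/

namespace PercRepro

namespace ZoneZ

namespace MultiExit

open ZoneData Pendant Finset TwoExit TreeClosure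

variable {V₁ E₁ U₁ U₂ : Type} (Z₁ : ZoneData V₁ E₁ U₁ U₂) (x y : V₁)

/-! ## The chord and the ear -/

/-- The host with the new edge `none` (the CHORD) from `x` to `y`. -/
def addEdge : ZoneData V₁ (Option E₁) U₁ U₂ where
  fst := fun e => match e with
    | some e => Z₁.fst e
    | none => x
  snd := fun e => match e with
    | some e => Z₁.snd e
    | none => y
  at₁ := Z₁.at₁
  at₂ := Z₁.at₂

/-- The first end of the chord. -/
theorem addEdge_fst_none : (addEdge Z₁ x y).fst none = x := rfl
/-- The second end of the chord. -/
theorem addEdge_snd_none : (addEdge Z₁ x y).snd none = y := rfl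
/-- The ends of an old edge. -/
theorem addEdge_fst_some (e : E₁) : (addEdge Z₁ x y).fst (some e) = Z₁.fst e := rfl
/-- The ends of an old edge. -/
theorem addEdge_snd_some (e : E₁) : (addEdge Z₁ x y).snd (some e) = Z₁.snd e := rfl

variable [DecidableEq E₁]

/-- The chord turned into a loop is the loop at `x`. -/
theorem loopify_addEdge : loopify (addEdge Z₁ x y) none = addLoop Z₁ x := by
  unfold loopify addLoop
  congr 1
  funext e
  cases e with
  | none => rw [Function.update_self, addEdge_fst_none]
  | some e => rw [Function.update_of_ne (Option.some_ne_none e), addEdge_snd_some]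

/-- The host with an EAR of length `n + 1` from `x` to `y`: the chord replaced by a path with `n` internal
vertices. -/
def ear (n : ℕ) : ZoneData (V₁ ⊕ Fin n) (Option E₁ ⊕ Fin n) U₁ U₂ := pathHost (addEdge Z₁ x y) none n

/-! ## THEOREM (EAR) -/

section Main

variable {ι : Type} (u : ι → V₁) (a₁ : V₁) (n : ℕ) [Fintype ι] [Fintype E₁]

/-- **THEOREM (EAR)**: the block map of the host with an ear of length `n + 1` from `x` to `y` is the block map of
the host with the chord `xy` plus `2^{n+1} − 2` times the block map of the host. -/
theorem blockMap_ear (w : ι → Vec6) :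
    blockMap (ear Z₁ x y n) (fun k => Sum.inl (u k)) (Sum.inl a₁) w =
      blockMap (addEdge Z₁ x y) u a₁ w + ((2 : ℝ) ^ (n + 1) - 2) • blockMap Z₁ u a₁ w := by
  unfold ear
  rw [blockMap_path, loopify_addEdge, blockMap_addLoop, smul_smul,
    show ((2 : ℝ) ^ n - 1) * 2 = 2 ^ (n + 1) - 2 by ring]

/-- `2^{n+1} − 2 ≥ 0`. -/
theorem two_pow_succ_sub_two_nonneg : (0 : ℝ) ≤ 2 ^ (n + 1) - 2 := by
  have h : (1 : ℝ) ≤ 2 ^ n := one_le_pow₀ (by norm_num)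
  rw [pow_succ]
  linarith

/-- **The cone conjecture for block maps is closed under adding an ear**: if the block maps of the host with the
chord and of the host send the family into the cone, so does the block map of the host with the ear. -/
theorem inCone_blockMap_ear (w : ι → Vec6) (h₁ : InCone (blockMap (addEdge Z₁ x y) u a₁ w))
    (h₂ : InCone (blockMap Z₁ u a₁ w)) :
    InCone (blockMap (ear Z₁ x y n) (fun k => Sum.inl (u k)) (Sum.inl a₁) w) := by
  rw [blockMap_ear]
  exact h₁.add (h₂.smul _ (two_pow_succ_sub_two_nonneg n))

/-- **Cone hosts are closed under adding an ear.** -/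
theorem coneHost_ear (h₁ : ConeHost (addEdge Z₁ x y) u a₁) (h₂ : ConeHost Z₁ u a₁) :
    ConeHost (ear Z₁ x y n) (fun k => Sum.inl (u k)) (Sum.inl a₁) :=
  fun w hw => inCone_blockMap_ear Z₁ x y u a₁ n w (h₁ w hw) (h₂ w hw)

end Main

end MultiExit

end ZoneZ

end PercRepro
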